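import Mathlib.RepresentationTheory.Invariants
import Mathlib.RepresentationTheory.Semisimple
import Mathlib.FieldTheory.AbsoluteGaloisGroup
import Mathlib.Topology.Algebra.OpenSubgroup
import Mathlib.NumberTheory.Cyclotomic.CyclotomicCharacter
import Mathlib.NumberTheory.Padics.PadicIntegers
import Literature.NumberTheory.GaloisRepresentations.AbsGaloisGroup
import Literature.AlgebraicGeometry.Motives.WeilCohomology
import HarnessLib

-- provenance: harness21/H21/H21/Prelude/MotiveAbstract/GaloisRealization.lean @ 6264bac (interim HEAD d8f2665); M5 mechanical rewrite
/-!
# Galois realisation: Tate classes and the Tate conjecture (trunk MotiveAbstract, prelude C12)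

Following Tate, *Conjectures on algebraic cycles in ℓ-adic cohomology*, PSPM 55 (1994) §1
(and SGA 4½ [Cycle]), a Weil cohomology theory `X ↦ H•(X)` with coefficients `K` (in practice
`K = ℚ_ℓ`, `H = H_ét(X_{k̄}, ℚ_ℓ)`) carries a `K`-linear action of the absolute Galois group
`Γ_k = Gal(k̄/k)`, compatible with pull-backs, cup products, the trace (up to the Tate twist) and
fixing the classes of algebraic cycles defined over `k`. Tate's conjecture `Tᵖ(X/k)` says that
the `Γ_k`-invariants of `H²ᵖ(X)(p)` are spanned by algebraic classes; the *Tate classes* are the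
classes fixed by some open subgroup of `Γ_k` (i.e. algebraic-looking after a finite extension).

## Main definitions

* `Literature.smoothInvariants ρ` : for a representation `ρ` of a topological group `Γ`, the subspace
  `⋃_U V^U` of vectors fixed by some open subgroup `U ≤ Γ` (pure linear algebra).
* `Literature.twistRep χ ρ j` : the twist `ρ ⊗ χʲ`, `g ↦ χ(g)ʲ • ρ(g)`, by an integer power of a
  `K`-valued character `χ : Γ →* Kˣ` (Tate twist when `χ` is the cyclotomic character).
* `Literature.padicCyclotomicCharacter k ℓ : Γ_k →* ℚ_[ℓ]ˣ` : Mathlib's `cyclotomicCharacter` of `k̄`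
  composed with the action `Γ_k → (k̄ ≃+* k̄)` and the inclusion `ℤ_[ℓ]ˣ → ℚ_[ℓ]ˣ`.
* `Literature.GaloisWeilCohomology k K χ` : hypothesis structure — a `WeilCohomology k K` together with
  representations `ρ X i : Γ_k → GL(Hⁱ(X))` subject to Tate's compatibilities; the twisting
  character `χ : Γ_k →* Kˣ` is a *parameter* (instantiate with `padicCyclotomicCharacter k ℓ`).
* `E.ρTwist X i j` (`Hⁱ(X)(j)`), `E.tateClasses X p`, `E.TateConjectureFor X p` (Tate's
  `Tᵖ(X/k)`), `E.TateSemisimplicityFor X i` (semisimplicity of `Hⁱ(X)`, via Mathlib's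
  `Representation.IsSemisimpleRepresentation`).

## Mathlib searches / design choices

* Mathlib has `Representation`, `Representation.invariants`, `Representation.IsSemisimpleRepresentation`
  (`Mathlib/RepresentationTheory/Semisimple.lean`), `cyclotomicCharacter`
  (`Mathlib/NumberTheory/Cyclotomic/CyclotomicCharacter.lean`), `OpenSubgroup`,
  `Field.absoluteGaloisGroup`; all are used. Mathlib has no smooth vectors / Tate twists of
  representations (searched `smooth`, `twist` in `RepresentationTheory`: nothing relevant) and its
  `Scheme.EllAdicCohomology` anchor carries no Galois action yet.
* Continuity of `ρ` (an ℓ-adic topology on `Hⁱ(X)`, cf. the GalRep trunk's continuous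
  representations) is deliberately **not** imposed: the Tate conjecture and the semisimplicity
  conjecture only use invariants and semisimplicity, both purely algebraic.
* The GalRep trunk (item C6) is to provide the *continuous* cyclotomic character
  `Γ_k →ₜ* ℤ_[ℓ]ˣ`; `padicCyclotomicCharacter` here is (by construction) its composite with
  `ℤ_[ℓ]ˣ → ℚ_[ℓ]ˣ`; the comparison lemma belongs there.

## References

* J. Tate, *Conjectures on algebraic cycles in ℓ-adic cohomology*, in Motives, PSPM 55 (1994), §1.
* P. Deligne, SGA 4½, [Cycle] (the cycle class in ℓ-adic cohomology).
-/

universe u v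

open CategoryTheory AlgebraicGeometry

noncomputable section

namespace Literature.AlgebraicGeometry.Motives

/-! ## Smooth vectors and twists (pure linear algebra) -/

section LinearAlgebra

variable {K : Type*} [Field K] {Γ : Type*} [Group Γ] {V : Type*} [AddCommGroup V] [Module K V]

section Smooth

variable [TopologicalSpace Γ]

/-- The subspace of **smooth invariants** of a representation `ρ` of a topological group `Γ`:
the vectors fixed by some open subgroup `U ≤ Γ`, i.e. `⨆_U V^{U}` over open subgroups `U`.
For `Γ = Gal(k̄/k)` acting on `H²ᵖ(X)(p)` these are the classes that become Galois invariant
over a finite extension of `k` (Tate 1994, §1, the space of "Tate classes"). [cite: Tate1994, §1  the space of "Tate classes"] -/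
def smoothInvariants (ρ : Representation K Γ V) : Submodule K V :=
  ⨆ U : OpenSubgroup Γ, Representation.invariants (ρ.comp (U : Subgroup Γ).subtype)

/-- A vector is a smooth invariant iff it is fixed by every element of some open subgroup
(Tate 1994, §1). The family `U ↦ V^U` is directed (intersections of open subgroups are open),
so the supremum is a union. [cite: Tate1994, §1] -/
theorem mem_smoothInvariants_iff (ρ : Representation K Γ V) (v : V) :
    v ∈ smoothInvariants ρ ↔ ∃ U : OpenSubgroup Γ, ∀ g ∈ U, ρ g v = v := by
  have hdir : Directed (· ≤ ·) (fun U : OpenSubgroup Γ ↦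
      (Representation.invariants (ρ.comp (U : Subgroup Γ).subtype) : Submodule K V)) := by
    intro U W
    refine ⟨U ⊓ W, ?_, ?_⟩
    · intro x hx g
      exact hx ⟨g, (OpenSubgroup.mem_inf.mp (show (g : Γ) ∈ U ⊓ W from g.2)).1⟩
    · intro x hx g
      exact hx ⟨g, (OpenSubgroup.mem_inf.mp (show (g : Γ) ∈ U ⊓ W from g.2)).2⟩
  rw [smoothInvariants, Submodule.mem_iSup_of_directed _ hdir]
  refine exists_congr fun U ↦ ⟨fun h g hg ↦ h ⟨g, hg⟩, fun h g ↦ h g g.2⟩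

/-- Invariant vectors are smooth invariants (take `U = ⊤`; Tate 1994, §1). [cite: Tate1994, §1] -/
theorem invariants_le_smoothInvariants (ρ : Representation K Γ V) :
    ρ.invariants ≤ smoothInvariants ρ := by
  intro v hv
  refine Submodule.mem_iSup_of_mem (⊤ : OpenSubgroup Γ) ?_
  intro g
  exact hv g

end Smooth

/-- The **twist** of a representation `ρ : Γ → GL(V)` by the `j`-th power (`j : ℤ`) of a
character `χ : Γ →* Kˣ`: `g ↦ χ(g)ʲ • ρ(g)`. When `χ` is the ℓ-adic cyclotomic character this
is the Tate twist `V(j)` (Tate 1994, §1). [cite: Tate1994, §1] -/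
def twistRep (χ : Γ →* Kˣ) (ρ : Representation K Γ V) (j : ℤ) : Representation K Γ V where
  toFun g := ((χ g : K) ^ j) • ρ g
  map_one' := by simp
  map_mul' g h := by
    rw [map_mul, map_mul, Units.val_mul, mul_zpow, smul_mul_smul_comm]

/-- `twistRep χ ρ j g v = χ(g)ʲ • ρ g v`. [folklore] -/
@[simp]
lemma twistRep_apply (χ : Γ →* Kˣ) (ρ : Representation K Γ V) (j : ℤ) (g : Γ) (v : V) :
    twistRep χ ρ j g v = ((χ g : K) ^ j) • ρ g v := rfl

/-- The `0`-th twist is the original representation (Tate 1994, §1, `V(0) = V`). [cite: Tate1994, §1   V(0] -/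
@[simp]
theorem twistRep_zero (χ : Γ →* Kˣ) (ρ : Representation K Γ V) : twistRep χ ρ 0 = ρ := by
  ext g v
  simp

end LinearAlgebra

/-! ## The ℓ-adic cyclotomic character of `Gal(k̄/k)` -/

section Cyclotomic

variable (k : Type u) [Field k]

/-- The **ℓ-adic cyclotomic character** `χ_ℓ : Gal(k̄/k) →* ℚ_ℓˣ`: Mathlib's
`cyclotomicCharacter (AlgebraicClosure k) ℓ : (k̄ ≃+* k̄) →* ℤ_[ℓ]ˣ` (characterised by
`g ζ = ζ ^ χ_ℓ(g)` on `ℓ`-power roots of unity) precomposed with the action of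
`Γ_k = Field.absoluteGaloisGroup k` on `k̄` and pushed to `ℚ_[ℓ]ˣ`. If `char k = ℓ` there are no
non-trivial `ℓ`-power roots of unity and this is the trivial character (Mathlib's convention).
The GalRep trunk provides the continuous `ℤ_[ℓ]ˣ`-valued version. Ref: Tate 1994, §1;
Serre, *Abelian ℓ-adic representations* (1968), I.1.2. [cite: Tate1994, §1] -/
def padicCyclotomicCharacter (ℓ : ℕ) [Fact ℓ.Prime] :
    Field.absoluteGaloisGroup k →* ℚ_[ℓ]ˣ :=
  (Units.map ↑(PadicInt.Coe.ringHom (p := ℓ))).comp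
    ((cyclotomicCharacter (AlgebraicClosure k) ℓ).comp
      (MulSemiringAction.toRingAut (Field.absoluteGaloisGroup k) (AlgebraicClosure k)))

end Cyclotomic

/-! ## Weil cohomology theories with Galois action -/

/-- A **Weil cohomology theory with Galois action** (hypothesis structure; Tate 1994, §1;
SGA 4½ [Cycle]): a Weil cohomology theory `H•` on smooth projective `k`-varieties with
coefficients in `K`, together with `K`-linear representations `ρ X i` of the absolute Galois
group `Γ_k = Gal(k̄/k)` on every `Hⁱ(X)` (the *untwisted* action; Tate twists `Hⁱ(X)(j)` are
*defined* from the parameter character `χ : Γ_k →* Kˣ`, see `ρTwist`), such that, on smooth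
projective varieties, pull-backs and cup products are equivariant, the trace
`H²ⁿ(X)(n) → K` is invariant and the classes of algebraic cycles (defined over `k`) in
`H²ᵖ(X)(p)` are Galois invariant.

The intended value is ℓ-adic étale cohomology `X ↦ H•_ét(X_{k̄}, ℚ_ℓ)` for `ℓ ≠ char k`, with
`χ = padicCyclotomicCharacter k ℓ` (Mathlib anchor: `Scheme.EllAdicCohomology`, which has no
Galois action yet). Continuity of `ρ` for the ℓ-adic topology is deliberately **not** required:
Tate's conjectures below only involve invariants and semisimplicity. [cite: Tate1994, §1] -/
structure GaloisWeilCohomology (k : Type u) [Field k] (K : Type v) [Field K] [CharZero K]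
    (χ : Field.absoluteGaloisGroup k →* Kˣ) extends WeilCohomology k K where
  /-- The action of `Gal(k̄/k)` on `Hⁱ(X)` (Tate 1994, §1). -/
  ρ (X : SchemeOver k) (i : ℕ) :
    Representation K (Field.absoluteGaloisGroup k) (toPreWeilCohomology.obj X i)
  /-- Pull-backs are Galois equivariant: `g ∘ f* = f* ∘ g` (Tate 1994, §1; functoriality of
  étale cohomology). -/
  pullback_ρ : ∀ ⦃n : ℕ⦄ ⦃X : SchemeOver k⦄, IsSmoothProjective n X →
    ∀ ⦃m : ℕ⦄ ⦃Y : SchemeOver k⦄, IsSmoothProjective m Y → ∀ (f : X ⟶ Y) (i : ℕ)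
      (g : Field.absoluteGaloisGroup k),
      ρ X i g ∘ₗ toPreWeilCohomology.pullback f i = toPreWeilCohomology.pullback f i ∘ₗ ρ Y i g
  /-- The cup product is Galois equivariant: `g (a ∪ b) = g a ∪ g b` (Tate 1994, §1). -/
  cup_ρ : ∀ ⦃n : ℕ⦄ ⦃X : SchemeOver k⦄, IsSmoothProjective n X →
    ∀ ⦃i j m : ℕ⦄ (h : i + j = m) (g : Field.absoluteGaloisGroup k)
      (a : toPreWeilCohomology.obj X i) (b : toPreWeilCohomology.obj X j),
      ρ X m g (cup h a b) = cup h (ρ X i g a) (ρ X j g b)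
  /-- The trace `H²ⁿ(X)(n) → K` is Galois invariant: `tr (χ(g)ⁿ • g x) = tr x`, `n = dim X`
  (Tate 1994, §1; SGA 4½ [Cycle] 2.3). -/
  trace_ρ : ∀ ⦃n : ℕ⦄ ⦃X : SchemeOver k⦄, IsSmoothProjective n X →
    ∀ (g : Field.absoluteGaloisGroup k) (x : toPreWeilCohomology.obj X (2 * n)),
      trace X n (((χ g : K) ^ (n : ℤ)) • ρ X (2 * n) g x) = trace X n x
  /-- The class in `H²ᵖ(X)(p)` of a prime cycle of codimension `p` (defined over `k`) is Galois
  invariant: `χ(g)ᵖ • g cl(Z) = cl(Z)` (Tate 1994, §1; SGA 4½ [Cycle] 2.2). -/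
  cycleClass_ρ : ∀ ⦃n : ℕ⦄ ⦃X : SchemeOver k⦄, IsSmoothProjective n X →
    ∀ (p : ℕ) (z : X.left), Order.coheight z = p → ∀ g : Field.absoluteGaloisGroup k,
      ((χ g : K) ^ (p : ℤ)) • ρ X (2 * p) g (cycleClass X p z) = cycleClass X p z

namespace GaloisWeilCohomology

variable {k : Type u} [Field k] {K : Type v} [Field K] [CharZero K]
  {χ : Field.absoluteGaloisGroup k →* Kˣ} (E : GaloisWeilCohomology k K χ)

/-- The Tate-twisted representation `Hⁱ(X)(j)`: `g ↦ χ(g)ʲ • ρ(g)` on `Hⁱ(X)` (Tate 1994, §1). [cite: Tate1994, §1] -/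
def ρTwist (X : SchemeOver k) (i : ℕ) (j : ℤ) :
    Representation K (Field.absoluteGaloisGroup k) (E.obj X i) :=
  twistRep χ (E.ρ X i) j

/-- `E.ρTwist X i j g x = χ(g)ʲ • E.ρ X i g x`. [folklore] -/
@[simp]
lemma ρTwist_apply (X : SchemeOver k) (i : ℕ) (j : ℤ) (g : Field.absoluteGaloisGroup k)
    (x : E.obj X i) : E.ρTwist X i j g x = ((χ g : K) ^ j) • E.ρ X i g x := rfl

/-- `Hⁱ(X)(0) = Hⁱ(X)` as representations. [folklore] -/
@[simp]
lemma ρTwist_zero (X : SchemeOver k) (i : ℕ) : E.ρTwist X i 0 = E.ρ X i :=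
  twistRep_zero χ (E.ρ X i)

/-- The space of **Tate classes** in `H²ᵖ(X)(p)`: classes fixed by some open subgroup of
`Gal(k̄/k)`, i.e. Galois invariant after a finite extension of `k` (Tate 1994, §1). [cite: Tate1994, §1] -/
def tateClasses (X : SchemeOver k) (p : ℕ) : Submodule K (E.obj X (2 * p)) :=
  smoothInvariants (E.ρTwist X (2 * p) p)

/-- **Tate's conjecture `Tᵖ(X/k)`** for `E` and `X` in codimension `p` (Tate 1994, §1,
Conjecture Tᵖ): the `K`-span of the classes of codimension-`p` algebraic cycles on `X` equals
the Galois invariants `(H²ᵖ(X)(p))^{Γ_k}`. The inclusion `⊆` holds for smooth projective `X`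
(`algebraicClasses_le_invariants`); the content is `⊇`. Stated as a `Prop`-valued definition
(open problem). [cite: Tate1994, §1  Conjecture Tᵖ] -/
def TateConjectureFor (X : SchemeOver k) (p : ℕ) : Prop :=
  E.algebraicClasses X p = (E.ρTwist X (2 * p) p).invariants

/-- **Tate's semisimplicity conjecture `Sⁱ(X/k)`** for `E` and `X` in degree `i` (Tate 1994,
§1): the Galois representation `Hⁱ(X)` is semisimple (Mathlib's
`Representation.IsSemisimpleRepresentation`: every subrepresentation has a complement).
Stated as a `Prop`-valued definition (open problem, known for abelian varieties over finitely
generated fields by Tate, Zarhin, Faltings). [cite: Tate1994, §1] -/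
def TateSemisimplicityFor (X : SchemeOver k) (i : ℕ) : Prop :=
  (E.ρ X i).IsSemisimpleRepresentation

/-- Algebraic classes are Galois invariant in `H²ᵖ(X)(p)` for smooth projective `X`
(Tate 1994, §1, the trivial inclusion of `Tᵖ(X/k)`); from `cycleClass_ρ` by linearity. [cite: Tate1994, §1  the trivial inclusion of  Tᵖ(X/k] -/
theorem algebraicClasses_le_invariants {n : ℕ} {X : SchemeOver k} (hX : IsSmoothProjective n X)
    (p : ℕ) : E.algebraicClasses X p ≤ (E.ρTwist X (2 * p) p).invariants := by
  refine Submodule.span_le.mpr ?_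
  change E.algebraicLattice X p ≤ (E.ρTwist X (2 * p) p).invariants.toAddSubgroup
  refine (AddSubgroup.closure_le _).mpr ?_
  rintro _ ⟨⟨z, hz⟩, rfl⟩ g
  exact E.cycleClass_ρ hX p z hz g

/-- Galois invariant classes are Tate classes (Tate 1994, §1). [cite: Tate1994, §1] -/
theorem invariants_le_tateClasses (X : SchemeOver k) (p : ℕ) :
    (E.ρTwist X (2 * p) p).invariants ≤ E.tateClasses X p :=
  invariants_le_smoothInvariants _

end GaloisWeilCohomology

end Literature.AlgebraicGeometry.Motives

end
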